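import Mathlib
import Literature.LinearAlgebra.Matrix.PermanentLaplace
import Summits.ValiantsHypothesis.ValiantsHypothesis.Theorems.ValuativeGCTValuativeFlipPencilBorderTools

/-!
# The degeneration step for per-class pencil ranks (crux `ValuativeGCT.ValuativeFlip`,
# stmt-ValiantsHypothesis-12624; wall-breaker k1 gen 1, axis "explicit per-side lower bounds")

Helper file (`--supports stmt-ValiantsHypothesis-12624`) for line `four-row-count`, heart stub
`stub_fourRowPencilRank` in its `m`-free form `H` (`fourRowPencilRank_of_pencilCertificate`):
`T(n) ≤ finrank span{X_t · (∂_ij per_n)(M·X)}` for one explicit pencil `M` per `n`.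

THE PENCIL AND THE INDUCTION (this seat's `Cruxes/ValuativeFlip/AxisK1G1HessenbergPencil.md`).  For the open
Hessenberg four-band pencil `HB_n` (`M_{r,r-1} = c_r y₀`, `M_{rr} = y₁`, `M_{r,r+1} = b_r y₂`, `M_{r,r+2} = d_r y₃`)
the span splits into charge classes `Q = w_t + i - j` (`w = (-1,0,1,2)`), and `rank_Q(n)` is bounded below
by induction on `n` through the degeneration `c_n → 0` of the last sub-diagonal entry:
every generator is AFFINE in `c_n`; at `c_n = 0` the interior generators become `y₁ ·` (the generators of
`HB_{n-1}`), the new last-row generators survive, and the Laplace relation along the last column produces one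
more direction in the span for `c_n ≠ 0`.  The abstract linear algebra of one such step is proved here:

* `hb_finrank_sup_ge` — if a linear map `e` kills `A`, then `finrank A + finrank (e B) ≤ finrank (A ⊔ B)`;
* `hb_degenerationStep_finite` — THE STEP ENGINE: for an affine family `G_c a = G₀ a + c • G₁ a`, a set `old`
  of indices with `e (G₀ a) = 0`, and extra vectors `N k` lying in `span (range G_c)` for every `c ≠ 0`, the
  parameters `c` with `finrank span (range G_c) < finrank span (G₀ '' old) + finrank span (range (e ∘ N))`
  form a FINITE set (`pb_finite_setOf_finrank_lt` applied to the family extended by `N`);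
  `hb_degenerationStep_exists` — hence such a bound holds at some (indeed almost every) `c ≠ 0`;
* `hb_permanent_affine_entry` — the permanent is affine in each entry, with slope the cofactor (Laplace
  along the entry's row), which is what makes pencil generators affine in one weight;
* `hb_permanent_submatrix_castSucc_castSucc_of_lastRow`, `hb_permanent_submatrix_castSucc_last_of_lastRow` —
  at `c_n = 0` (last row supported on the corner): interior cofactors are `corner ×` the cofactors of the
  top-left block and the cofactors deleting the last column vanish; and their pencil forms
  `hb_aeval_pderiv_perPoly_castSucc_castSucc_of_lastRow`, `hb_aeval_pderiv_perPoly_castSucc_last_of_lastRow`,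
  `hb_aeval_pderiv_perPoly_last_castSucc` (the Laplace relation among last-row generators) in the format of `H`.

All statements are folklore linear algebra / Laplace expansion (Minc, *Permanents* (1978) §1.2); nothing is
specific to the crux beyond the choice of what to package.
-/

set_option linter.dupNamespace false

namespace Summit.ValiantsHypothesis.ValiantsHypothesis.Theorems.ValuativeFlip

open scoped BigOperators Matrix
open MvPolynomial

section LinearAlgebra

/-- If a linear map `e` kills the subspace `A`, then `finrank A + finrank (e B) ≤ finrank (A ⊔ B)`
(rank–nullity for `e` restricted to `A ⊔ B`: its kernel contains `A`, its image contains `e B`).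
[folklore] -/
theorem hb_finrank_sup_ge {K V W : Type*} [Field K] [AddCommGroup V] [Module K V] [AddCommGroup W]
    [Module K W] (A B : Submodule K V) [FiniteDimensional K ↥(A ⊔ B)] (e : V →ₗ[K] W)
    (hA : A ≤ LinearMap.ker e) :
    Module.finrank K ↥A + Module.finrank K ↥(B.map e) ≤ Module.finrank K ↥(A ⊔ B) := by
  set f : ↥(A ⊔ B) →ₗ[K] W := e.domRestrict (A ⊔ B) with hf
  have hrn := LinearMap.finrank_range_add_finrank_ker f
  -- image
  have hrange : B.map e ≤ LinearMap.range f := by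
    rw [hf, LinearMap.range_domRestrict]
    exact Submodule.map_mono le_sup_right
  haveI : FiniteDimensional K ↥(LinearMap.range f) := LinearMap.finiteDimensional_range f
  have h1 : Module.finrank K ↥(B.map e) ≤ Module.finrank K ↥(LinearMap.range f) :=
    Submodule.finrank_mono hrange
  -- kernel
  have hker : (A.comap (A ⊔ B).subtype) ≤ LinearMap.ker f := by
    intro x hx
    rw [LinearMap.mem_ker, hf, LinearMap.domRestrict_apply]
    exact hA hx
  have h2 : Module.finrank K ↥A ≤ Module.finrank K ↥(LinearMap.ker f) := by
    have hcomap : Module.finrank K ↥(A.comap (A ⊔ B).subtype) = Module.finrank K ↥A :=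
      (Submodule.comapSubtypeEquivOfLe (le_sup_left : A ≤ A ⊔ B)).finrank_eq
    rw [← hcomap]
    exact Submodule.finrank_mono hker
  omega

/-- **The degeneration step.**  Let `G_c a = G₀ a + c • G₁ a` be an affine one-parameter family of finite
families of vectors, `old` a set of indices whose `c = 0` values are killed by a linear map `e`, and `N` a
finite family of further vectors lying in `span (range G_c)` for every `c ≠ 0` (in the application: the new
generators, and the slopes of relations among the `c = 0` values).  Then for all but finitely many `c`,
`finrank span (G₀ '' old) + finrank span (range (e ∘ N)) ≤ finrank span (range G_c)`:
the span of the extended family `G_c ∪ N` does not drop below its `c = 0` value off a finite set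
(`pb_finite_setOf_finrank_lt`), equals `span (range G_c)` for `c ≠ 0`, and at `c = 0` contains
`span (G₀ '' old) ⊔ span (range N)`, whose dimension `hb_finrank_sup_ge` bounds below. [folklore] -/
theorem hb_degenerationStep_finite {K V W ι κ : Type*} [Field K] [AddCommGroup V] [Module K V]
    [AddCommGroup W] [Module K W] [Fintype ι] [Fintype κ] (G₀ G₁ : ι → V) (N : κ → V)
    (e : V →ₗ[K] W) (old : Set ι) (hold : ∀ a ∈ old, e (G₀ a) = 0)
    (hN : ∀ c : K, c ≠ 0 → ∀ k, N k ∈ Submodule.span K (Set.range fun a => G₀ a + c • G₁ a)) :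
    Set.Finite {c : K | Module.finrank K ↥(Submodule.span K (Set.range fun a => G₀ a + c • G₁ a)) <
      Module.finrank K ↥(Submodule.span K (G₀ '' old)) +
        Module.finrank K ↥(Submodule.span K (Set.range (e ∘ N)))} := by
  classical
  -- the extended affine family on `ι ⊕ κ`
  set H₀ : ι ⊕ κ → V := Sum.elim G₀ N with hH₀
  set H₁ : ι ⊕ κ → V := Sum.elim G₁ 0 with hH₁
  have hfin := (pb_finite_setOf_finrank_lt H₀ H₁).union (Set.finite_singleton (0 : K))
  refine hfin.subset fun c hc => ?_
  rw [Set.mem_setOf_eq] at hc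
  simp only [Set.mem_union, Set.mem_setOf_eq, Set.mem_singleton_iff]
  by_contra hcon
  have hge : ¬ Module.finrank K ↥(Submodule.span K (Set.range fun x => H₀ x + c • H₁ x)) <
      Module.finrank K ↥(Submodule.span K (Set.range H₀)) := fun h => hcon (Or.inl h)
  have hc0 : c ≠ 0 := fun h => hcon (Or.inr h)
  -- for `c ≠ 0` the extended family spans the same space
  have hHc : Submodule.span K (Set.range fun x => H₀ x + c • H₁ x) =
      Submodule.span K (Set.range fun a => G₀ a + c • G₁ a) := by
    apply le_antisymm
    · refine Submodule.span_le.mpr ?_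
      rintro v ⟨x, rfl⟩
      cases x with
      | inl a => exact Submodule.subset_span ⟨a, by simp [hH₀, hH₁]⟩
      | inr k => simpa [hH₀, hH₁] using hN c hc0 k
    · refine Submodule.span_mono ?_
      rintro v ⟨a, rfl⟩
      exact ⟨Sum.inl a, by simp [hH₀, hH₁]⟩
  -- at `c = 0` the extended family contains `G₀ '' old` and `range N`
  have hA : Submodule.span K (G₀ '' old) ≤ Submodule.span K (Set.range H₀) :=
    Submodule.span_mono (by rintro v ⟨a, -, rfl⟩; exact ⟨Sum.inl a, by simp [hH₀]⟩)
  have hB : Submodule.span K (Set.range N) ≤ Submodule.span K (Set.range H₀) :=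
    Submodule.span_mono (by rintro v ⟨k, rfl⟩; exact ⟨Sum.inr k, by simp [hH₀]⟩)
  haveI : FiniteDimensional K ↥(Submodule.span K (Set.range H₀)) :=
    Module.Finite.span_of_finite K (Set.finite_range _)
  haveI : FiniteDimensional K ↥(Submodule.span K (G₀ '' old) ⊔ Submodule.span K (Set.range N)) :=
    Submodule.finiteDimensional_of_le (sup_le hA hB)
  have hkill : Submodule.span K (G₀ '' old) ≤ LinearMap.ker e := by
    refine Submodule.span_le.mpr ?_
    rintro v ⟨a, ha, rfl⟩
    exact hold a ha
  have hmap : (Submodule.span K (Set.range N)).map e = Submodule.span K (Set.range (e ∘ N)) := by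
    rw [Submodule.map_span, ← Set.range_comp]
  have hstep := hb_finrank_sup_ge (Submodule.span K (G₀ '' old)) (Submodule.span K (Set.range N)) e hkill
  rw [hmap] at hstep
  have hsup : Module.finrank K ↥(Submodule.span K (G₀ '' old) ⊔ Submodule.span K (Set.range N)) ≤
      Module.finrank K ↥(Submodule.span K (Set.range H₀)) :=
    Submodule.finrank_mono (sup_le hA hB)
  have hge' : Module.finrank K ↥(Submodule.span K (Set.range H₀)) ≤
      Module.finrank K ↥(Submodule.span K (Set.range fun x => H₀ x + c • H₁ x)) := not_lt.mp hge
  rw [hHc] at hge'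
  omega

/-- The degeneration step, existence form: over an infinite field some `c ≠ 0` (indeed all but finitely
many) achieves `finrank span (G₀ '' old) + finrank span (range (e ∘ N)) ≤ finrank span (range G_c)`.
[folklore] -/
theorem hb_degenerationStep_exists {K V W ι κ : Type*} [Field K] [Infinite K] [AddCommGroup V]
    [Module K V] [AddCommGroup W] [Module K W] [Fintype ι] [Fintype κ] (G₀ G₁ : ι → V)
    (N : κ → V) (e : V →ₗ[K] W) (old : Set ι) (hold : ∀ a ∈ old, e (G₀ a) = 0)
    (hN : ∀ c : K, c ≠ 0 → ∀ k, N k ∈ Submodule.span K (Set.range fun a => G₀ a + c • G₁ a)) :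
    ∃ c : K, c ≠ 0 ∧ Module.finrank K ↥(Submodule.span K (G₀ '' old)) +
        Module.finrank K ↥(Submodule.span K (Set.range (e ∘ N))) ≤
      Module.finrank K ↥(Submodule.span K (Set.range fun a => G₀ a + c • G₁ a)) := by
  have hfin := (hb_degenerationStep_finite G₀ G₁ N e old hold hN).union (Set.finite_singleton (0 : K))
  obtain ⟨c, hc⟩ := hfin.infinite_compl.nonempty
  simp only [Set.mem_compl_iff, Set.mem_union, Set.mem_setOf_eq, Set.mem_singleton_iff, not_or,
    not_lt] at hc
  exact ⟨c, hc.2, hc.1⟩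

end LinearAlgebra

section Permanent

variable {S : Type*} [CommRing S] {n : ℕ}

/-- **The permanent is affine in each entry**, with slope the cofactor: if `B₀` agrees with `B` except that
the entry `(p, q)` is replaced by `0`, then `per B = per B₀ + B p q · per B(p | q)` (Laplace expansion of
both along row `p`; the minors do not see row `p`). [Minc 1978 §1.2; folklore] -/
theorem hb_permanent_affine_entry (B B₀ : Matrix (Fin (n + 1)) (Fin (n + 1)) S) (p q : Fin (n + 1))
    (hoff : ∀ i j, (i, j) ≠ (p, q) → B₀ i j = B i j) (h0 : B₀ p q = 0) :
    B.permanent = B₀.permanent + B p q * (B.submatrix p.succAbove q.succAbove).permanent := by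
  have hminor : ∀ j : Fin (n + 1),
      B₀.submatrix p.succAbove j.succAbove = B.submatrix p.succAbove j.succAbove := by
    intro j
    ext a b
    simp only [Matrix.submatrix_apply]
    exact hoff _ _ fun h => Fin.succAbove_ne p a (Prod.mk.inj h).1
  rw [Matrix.permanent_eq_sum_row B p, Matrix.permanent_eq_sum_row B₀ p,
    ← Finset.add_sum_erase _ _ (Finset.mem_univ q), ← Finset.add_sum_erase _ _ (Finset.mem_univ q), h0,
    zero_mul, zero_add, add_comm]
  congr 1
  refine Finset.sum_congr rfl fun j hj => ?_
  rw [hminor j, hoff p j fun h => (Finset.mem_erase.mp hj).1 (Prod.mk.inj h).2]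

/-- A matrix with a zero row has permanent `0`. [folklore] -/
theorem hb_permanent_eq_zero_of_row_eq_zero {ι : Type*} [Fintype ι] [DecidableEq ι] (M : Matrix ι ι S)
    (i₀ : ι) (h : ∀ j, M i₀ j = 0) : M.permanent = 0 := by
  rw [← Matrix.permanent_transpose]
  unfold Matrix.permanent
  exact Finset.sum_eq_zero fun σ _ => Finset.prod_eq_zero (Finset.mem_univ i₀) (by simp [h])

/-- At the degenerate parameter (the last row of `B = [[A, u], [0, z]]` supported on the corner): deleting
an OLD row `k` and an OLD column `l` gives `per B(k | l) = z · per A(k | l)` — the interior cofactors are the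
corner times the cofactors of the top-left block (the `B₀`-term of
`pb_permanent_submatrix_castSucc_castSucc` has a zero last row). [Minc 1978 §1.2; folklore] -/
theorem hb_permanent_submatrix_castSucc_castSucc_of_lastRow (B : Matrix (Fin (n + 2)) (Fin (n + 2)) S)
    (A : Matrix (Fin (n + 1)) (Fin (n + 1)) S) (hA : ∀ i j, B (Fin.castSucc i) (Fin.castSucc j) = A i j)
    (hv : ∀ j, B (Fin.last (n + 1)) (Fin.castSucc j) = 0) (k l : Fin (n + 1)) :
    (B.submatrix (Fin.castSucc k).succAbove (Fin.castSucc l).succAbove).permanent =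
      B (Fin.last (n + 1)) (Fin.last (n + 1)) * (A.submatrix k.succAbove l.succAbove).permanent := by
  classical
  -- `B₀` := `B` with the corner replaced by `0`
  set B₀ : Matrix (Fin (n + 2)) (Fin (n + 2)) S :=
    Matrix.of fun i j => if i = Fin.last (n + 1) ∧ j = Fin.last (n + 1) then 0 else B i j with hB₀
  have hrows : ∀ i j, B₀ (Fin.castSucc i) j = B (Fin.castSucc i) j := by
    intro i j
    simp [hB₀, (Fin.castSucc_lt_last i).ne]
  have hlast : ∀ j, B₀ (Fin.last (n + 1)) (Fin.castSucc j) = B (Fin.last (n + 1)) (Fin.castSucc j) := by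
    intro j
    simp [hB₀, (Fin.castSucc_lt_last j).ne]
  have h0 : B₀ (Fin.last (n + 1)) (Fin.last (n + 1)) = 0 := by simp [hB₀]
  rw [pb_permanent_submatrix_castSucc_castSucc B B₀ A hA hrows hlast h0 k l]
  have hzero : (B₀.submatrix (Fin.castSucc k).succAbove (Fin.castSucc l).succAbove).permanent = 0 := by
    refine hb_permanent_eq_zero_of_row_eq_zero _ (Fin.last n) fun j => ?_
    rw [Matrix.submatrix_apply, pb_succAbove_castSucc_last]
    -- the column index is either an old column or the corner column
    rcases Fin.eq_castSucc_or_eq_last ((Fin.castSucc l).succAbove j) with ⟨j', hj'⟩ | hj'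
    · rw [hj', hlast, hv]
    · rw [hj', h0]
  rw [hzero, add_zero]

/-- At the degenerate parameter (last row supported on the corner): deleting an OLD row `k` and the LAST
column gives a matrix with a zero row, so `per B(k | last) = 0` — the new "upper" cofactors vanish at
`c = 0` (they are the `c`-multiples recovered as slopes). [folklore] -/
theorem hb_permanent_submatrix_castSucc_last_of_lastRow (B : Matrix (Fin (n + 2)) (Fin (n + 2)) S)
    (hv : ∀ j, B (Fin.last (n + 1)) (Fin.castSucc j) = 0) (k : Fin (n + 1)) :
    (B.submatrix (Fin.castSucc k).succAbove (Fin.last (n + 1)).succAbove).permanent = 0 := by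
  refine hb_permanent_eq_zero_of_row_eq_zero _ (Fin.last n) fun j => ?_
  rw [Matrix.submatrix_apply, pb_succAbove_castSucc_last, Fin.succAbove_last, hv]

end Permanent

section Pencil

open Literature.Computability.AlgebraicComplexity

variable {K A : Type*} [CommRing K] [CommRing A] [Algebra K A] {n : ℕ}

/-- **Interior generators at the degenerate parameter factor through the smaller size.**  For an
algebra-valued point `φ` of the `(n+2) × (n+2)` generic matrix whose last row is supported on the corner,
`(∂_{kl} per_{n+2})(φ) = φ(last,last) · (∂_{kl} per_{n+1})(φ|_{(n+1)×(n+1)})` for old `k, l`; in the pencil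
`HB_n` at `c_n = 0` this reads "interior generator `= y₁ ·` generator of `HB_{n-1}`". [folklore] -/
theorem hb_aeval_pderiv_perPoly_castSucc_castSucc_of_lastRow (φ : Fin (n + 2) × Fin (n + 2) → A)
    (hv : ∀ j : Fin (n + 1), φ (Fin.last (n + 1), Fin.castSucc j) = 0) (k l : Fin (n + 1)) :
    MvPolynomial.aeval φ (MvPolynomial.pderiv (Fin.castSucc k, Fin.castSucc l) (perPoly (Fin (n + 2)) K)) =
      φ (Fin.last (n + 1), Fin.last (n + 1)) *
        MvPolynomial.aeval (fun q : Fin (n + 1) × Fin (n + 1) => φ (Fin.castSucc q.1, Fin.castSucc q.2))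
          (MvPolynomial.pderiv (k, l) (perPoly (Fin (n + 1)) K)) := by
  rw [pb_aeval_pderiv_perPoly, pb_aeval_pderiv_perPoly]
  exact hb_permanent_submatrix_castSucc_castSucc_of_lastRow (Matrix.of fun i j => φ (i, j))
    (Matrix.of fun i j => φ (Fin.castSucc i, Fin.castSucc j)) (fun i j => rfl) hv k l

/-- At the degenerate parameter the generators deleting the LAST column vanish:
`(∂_{k,last} per_{n+2})(φ) = 0` when the last row of `φ` is supported on the corner. [folklore] -/
theorem hb_aeval_pderiv_perPoly_castSucc_last_of_lastRow (φ : Fin (n + 2) × Fin (n + 2) → A)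
    (hv : ∀ j : Fin (n + 1), φ (Fin.last (n + 1), Fin.castSucc j) = 0) (k : Fin (n + 1)) :
    MvPolynomial.aeval φ (MvPolynomial.pderiv (Fin.castSucc k, Fin.last (n + 1)) (perPoly (Fin (n + 2)) K)) =
      0 := by
  rw [pb_aeval_pderiv_perPoly]
  exact hb_permanent_submatrix_castSucc_last_of_lastRow (Matrix.of fun i j => φ (i, j)) hv k

/-- **The Laplace relation among last-row generators** (valid at EVERY parameter, since the last row is
deleted): `(∂_{last,l} per_{n+2})(φ) = Σ_i φ(i, last) · (∂_{il} per_{n+1})(φ|)` — expansion of the cofactor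
along the border column.  In `HB_n` only two border entries are nonzero (`b_{n-1} y₂`, `d_{n-2} y₃`), giving the
relation `Per_{n,j} = b_{n-1} y₂ Per⁽ⁿ⁻¹⁾_{n-1,j} + d_{n-2} y₃ Per⁽ⁿ⁻¹⁾_{n-2,j}` whose `c_n`-slope is the extra
direction of the step. [Minc 1978 §1.2; folklore] -/
theorem hb_aeval_pderiv_perPoly_last_castSucc (φ : Fin (n + 2) × Fin (n + 2) → A) (l : Fin (n + 1)) :
    MvPolynomial.aeval φ (MvPolynomial.pderiv (Fin.last (n + 1), Fin.castSucc l) (perPoly (Fin (n + 2)) K)) =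
      ∑ i : Fin (n + 1), φ (Fin.castSucc i, Fin.last (n + 1)) *
        MvPolynomial.aeval (fun q : Fin (n + 1) × Fin (n + 1) => φ (Fin.castSucc q.1, Fin.castSucc q.2))
          (MvPolynomial.pderiv (i, l) (perPoly (Fin (n + 1)) K)) := by
  rw [pb_aeval_pderiv_perPoly]
  rw [pb_permanent_submatrix_last_castSucc (Matrix.of fun i j => φ (i, j))
    (Matrix.of fun i j => φ (Fin.castSucc i, Fin.castSucc j)) (fun i => φ (Fin.castSucc i, Fin.last (n + 1)))
    (fun i j => rfl) (fun i => rfl) l]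
  refine Finset.sum_congr rfl fun i _ => ?_
  rw [pb_aeval_pderiv_perPoly]

/-- The same three facts in the format of `H` (`fourRowPencilRank_of_pencilCertificate`): for a pencil of
linear forms `φ q = Σ_s M q s • X_s` whose last row vanishes off the corner, the interior generator
`X_t · (∂_{kl} per_{n+2})(φ)` is `φ(last,last) ·` the corresponding generator of the top-left `(n+1)`-pencil.
[folklore] -/
theorem hb_generator_castSucc_castSucc_of_lastRow {σ R : Type*} [CommRing R]
    (φ : Fin (n + 2) × Fin (n + 2) → MvPolynomial σ R)
    (hv : ∀ j : Fin (n + 1), φ (Fin.last (n + 1), Fin.castSucc j) = 0) (g : MvPolynomial σ R)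
    (k l : Fin (n + 1)) :
    g * MvPolynomial.aeval φ (MvPolynomial.pderiv (Fin.castSucc k, Fin.castSucc l) (perPoly (Fin (n + 2)) R)) =
      φ (Fin.last (n + 1), Fin.last (n + 1)) *
        (g * MvPolynomial.aeval (fun q : Fin (n + 1) × Fin (n + 1) => φ (Fin.castSucc q.1, Fin.castSucc q.2))
          (MvPolynomial.pderiv (k, l) (perPoly (Fin (n + 1)) R))) := by
  rw [hb_aeval_pderiv_perPoly_castSucc_castSucc_of_lastRow φ hv k l]
  ring

end Pencil

end Summit.ValiantsHypothesis.ValiantsHypothesis.Theorems.ValuativeFlip
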